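import Summits.SmoothPoincare4.SmoothPoincare4.Theorems.ConvexBisectionAcyclicBisectionExistsT3AssemblyClosedN0
import Literature.Topology.FourManifolds.OrientedConnectedSumTransportProofs
import Literature.Topology.FourManifolds.HandleAttachingMapsTransport
import HarnessLib

/-!
# Dual handles, node Hgap ("T3c-3 WITH DATA"), part A-4: the seam correspondence of TRANSPORTED data —
# values and differentials of `D'.jA = D.jA ∘ G⁻¹` at the image points `G a`
(sub-goal of stub `stub_T3_dualPresentation` (T3), line `modp-braid-orbits`, crux
`ConvexBisection.AcyclicBisectionExists`, item stmt-SmoothPoincare4-10508; wave 6, lead c5, worker G1;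
registered sub-goal `helper_mfderiv_jA_transport`)

The orientation-character clause `Hχ` of the node Hgap (worker G3) compares seam frames read through
`d(D₁.jA)` and `d(D₂p.jA)`, where `D₂p` is the TRANSPORT of X1's dual data `D₂` along the time-`1` map
`G = S_1` of the universal straightening (`Hgap_transport`, `…HgapTransport.lean`:
`D₂p.jA a = D₂.jA (coresComplementCongr _ G a)`, i.e. `D₂p.jA = D₂.jA ∘ G⁻¹` on the cores complements).
This file records, for ANY diffeomorphism `G : M ≅ M'` of attaching manifolds and any data `D'` along
`G ∘ q` with this `jA`-formula, the two facts that turn the OLD seam correspondence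
(`b₂.incl (φ y) = D₂.jA a'`, frames `d(D₂.jA)_{a'} (v₂ k)`) into the NEW one:

* `jA_transport_apply_image`: `D'.jA (G a) = D.jA a` (the new unsurgered point over an old one is `G a`,
  `apply_mem_coresComplement_transport`);
* `mfderiv_jA_transport_apply_image`: `d(D'.jA)_{G a} (dG_a v) = d(D.jA)_a v` (chain rule through the
  restriction `coresComplementCongr q G` of `G⁻¹` to the open cores complements, `mfderiv_opens_eq`, and
  `dG⁻¹_{G a} ∘ dG_a = id`), so the new frame is `v₂' k = dG (v₂ k)` at `G a'`.

Everything is proved; no named facts, no `sorry`, no `def`.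

## References
* A. A. Kosinski, *Differential Manifolds* (1993), VI §6 and VIII, proof of (1.2). [Kosinski1993]
* J. M. Lee, *Introduction to Smooth Manifolds* (2013), Prop. 3.9 (tangent space of an open submanifold). [LeeSmoothManifolds2013]
-/

noncomputable section

-- the prescribed namespace `Summit.<P>.<Sub>.…` duplicates `SmoothPoincare4` (P = Sub)
set_option linter.dupNamespace false

open scoped Manifold ContDiff Topology

namespace Summit.SmoothPoincare4.SmoothPoincare4.Theorems.AcyclicBisectionExists.ModpBraidOrbits

open Set Function Metric
open Literature.Topology.FourManifolds Literature.Topology.FourManifolds.HandleAttachingMap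

namespace HgapTransport

section Deriv

variable {M : Type} [TopologicalSpace M] [ChartedSpace (EuclideanHalfSpace 4) M] [IsManifold (𝓡∂ 4) ∞ M]
  [T2Space M] {M' : Type} [TopologicalSpace M'] [ChartedSpace (EuclideanHalfSpace 4) M']
  [IsManifold (𝓡∂ 4) ∞ M'] [T2Space M']
  {ι : Type} [Finite ι] {q : ι → HandleAttachingMap 3 2 M}
  {P : Type} [TopologicalSpace P] [ChartedSpace (EuclideanHalfSpace 4) P]

/-- **The transported `jA` at an image point**: `D'.jA (G a) = D.jA a` when `D'.jA = D.jA ∘ G⁻¹`.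
[cite: Kosinski1993, VI §6 and VIII proof of (1.2)] -/
theorem jA_transport_apply_image (D : MultiAttachmentData q (𝓡∂ 4) P) (G : M ≃ₘ⟮𝓡∂ 4, 𝓡∂ 4⟯ M')
    (D' : MultiAttachmentData (fun i => (q i).transport G) (𝓡∂ 4) P)
    (hA : ∀ a, D'.jA a = D.jA (coresComplementCongr q G a)) (a : ↥(coresComplement q)) :
    D'.jA ⟨G a, apply_mem_coresComplement_transport q G a.2⟩ = D.jA a := by
  rw [hA]
  congr 1
  apply Subtype.ext
  rw [coe_coresComplementCongr]
  exact G.symm_apply_apply _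

/-- **The differential of the restriction `coresComplementCongr q G` of `G⁻¹` to the open cores
complements is that of `G⁻¹`** (`mfderiv_opens_eq`). [cite: LeeSmoothManifolds2013, Prop. 3.9] -/
theorem mfderiv_coresComplementCongr (G : M ≃ₘ⟮𝓡∂ 4, 𝓡∂ 4⟯ M')
    (a' : ↥(coresComplement fun i => (q i).transport G)) :
    mfderiv (𝓡∂ 4) (𝓡∂ 4) (coresComplementCongr q G) a' = mfderiv (𝓡∂ 4) (𝓡∂ 4) G.symm (a' : M') :=
  mfderiv_opens_eq (f := (G.symm : M' → M)) (g := coresComplementCongr q G)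
    (fun y => coe_coresComplementCongr q G y) (G.symm.contMDiff.mdifferentiableAt (by simp))

omit [IsManifold (𝓡∂ 4) ∞ M] [T2Space M] [IsManifold (𝓡∂ 4) ∞ M'] [T2Space M'] in
/-- `dG⁻¹_{G x} (dG_x v) = v` for a diffeomorphism `G`. [folklore] -/
theorem mfderiv_symm_mfderiv_apply (G : M ≃ₘ⟮𝓡∂ 4, 𝓡∂ 4⟯ M') (x : M) (v : EuclideanSpace ℝ (Fin 4)) :
    mfderiv (𝓡∂ 4) (𝓡∂ 4) G.symm (G x) (mfderiv (𝓡∂ 4) (𝓡∂ 4) G x v) = v := by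
  have hd1 : MDifferentiableAt (𝓡∂ 4) (𝓡∂ 4) G x := (G.contMDiff x).mdifferentiableAt (by simp)
  have hd2 : MDifferentiableAt (𝓡∂ 4) (𝓡∂ 4) G.symm (G x) := (G.symm.contMDiff (G x)).mdifferentiableAt (by simp)
  have hcomp := mfderiv_comp x hd2 hd1
  have hid : ((G.symm : M' → M) ∘ (G : M → M')) = id := funext G.symm_apply_apply
  rw [hid, mfderiv_id] at hcomp
  have := congrArg (fun L : EuclideanSpace ℝ (Fin 4) →L[ℝ] EuclideanSpace ℝ (Fin 4) => L v) hcomp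
  exact this.symm

/-- **The differential of the transported `jA` at an image point**:
`d(D'.jA)_{G a} (dG_a v) = d(D.jA)_a v` when `D'.jA = D.jA ∘ G⁻¹` (chain rule; so old seam frames
`d(D.jA)_a (v k)` are the new seam frames `d(D'.jA)_{G a} (dG_a (v k))`).
[cite: Kosinski1993, VI §6 and VIII proof of (1.2)] -/
theorem mfderiv_jA_transport_apply_image (D : MultiAttachmentData q (𝓡∂ 4) P)
    (G : M ≃ₘ⟮𝓡∂ 4, 𝓡∂ 4⟯ M') (D' : MultiAttachmentData (fun i => (q i).transport G) (𝓡∂ 4) P)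
    (hA : ∀ a, D'.jA a = D.jA (coresComplementCongr q G a)) (a : ↥(coresComplement q))
    (v : EuclideanSpace ℝ (Fin 4)) :
    mfderiv (𝓡∂ 4) (𝓡∂ 4) D'.jA ⟨G a, apply_mem_coresComplement_transport q G a.2⟩
        (mfderiv (𝓡∂ 4) (𝓡∂ 4) G (a : M) v) =
      mfderiv (𝓡∂ 4) (𝓡∂ 4) D.jA a v := by
  obtain ⟨a'', ha''⟩ : ∃ a'' : ↥(coresComplement fun i => (q i).transport G),
      a'' = ⟨G a, apply_mem_coresComplement_transport q G a.2⟩ := ⟨_, rfl⟩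
  have hcongr : coresComplementCongr q G a'' = a := by
    apply Subtype.ext
    rw [coe_coresComplementCongr, ha'']
    exact G.symm_apply_apply _
  have hcoe : (a'' : M') = G a := by rw [ha'']
  rw [← ha'']
  have hfun : D'.jA = D.jA ∘ coresComplementCongr q G := funext hA
  rw [hfun]
  have hC : MDifferentiableAt (𝓡∂ 4) (𝓡∂ 4) (coresComplementCongr q G) a'' :=
    (coresComplementCongr q G).contMDiff.mdifferentiableAt (by simp)
  have hJ : MDifferentiableAt (𝓡∂ 4) (𝓡∂ 4) D.jA (coresComplementCongr q G a'') :=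
    (D.hjA.contMDiff _).mdifferentiableAt (by simp)
  rw [mfderiv_comp a'' hJ hC, mfderiv_coresComplementCongr, hcongr, hcoe]
  show (mfderiv (𝓡∂ 4) (𝓡∂ 4) D.jA a)
      (mfderiv (𝓡∂ 4) (𝓡∂ 4) G.symm (G a) (mfderiv (𝓡∂ 4) (𝓡∂ 4) G (a : M) v)) = _
  rw [mfderiv_symm_mfderiv_apply]

/-- **Frame transfer**: if old frames correspond, `L k = d(D.jA)_a (v k)`, then they correspond to the
pushed frames through the transported data: `L k = d(D'.jA)_{G a} (dG_a (v k))`. [folklore] -/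
theorem frames_transport {D : MultiAttachmentData q (𝓡∂ 4) P} {G : M ≃ₘ⟮𝓡∂ 4, 𝓡∂ 4⟯ M'}
    {D' : MultiAttachmentData (fun i => (q i).transport G) (𝓡∂ 4) P}
    (hA : ∀ a, D'.jA a = D.jA (coresComplementCongr q G a)) {a : ↥(coresComplement q)}
    {m : ℕ} {L : Fin m → EuclideanSpace ℝ (Fin 4)} {v : Fin m → EuclideanSpace ℝ (Fin 4)}
    (hL : ∀ k, L k = mfderiv (𝓡∂ 4) (𝓡∂ 4) D.jA a (v k)) (k : Fin m) :
    L k = mfderiv (𝓡∂ 4) (𝓡∂ 4) D'.jA ⟨G a, apply_mem_coresComplement_transport q G a.2⟩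
      (mfderiv (𝓡∂ 4) (𝓡∂ 4) G (a : M) (v k)) := by
  rw [mfderiv_jA_transport_apply_image D G D' hA, hL k]

end Deriv

end HgapTransport

open HgapTransport

/-! ## Registered helper -/

/-- **Sub-goal `helper_mfderiv_jA_transport` of stub `stub_T3_dualPresentation`** (node Hgap, part A-4;
wave 6, lead c5): for multi-attachment data `D'` along the transported family `G ∘ q` with
`D'.jA = D.jA ∘ G⁻¹` on the cores complements, at the image `G a` of an unsurgered point `a`:
`D'.jA (G a) = D.jA a` and `d(D'.jA)_{G a} (dG_a v) = d(D.jA)_a v`. [cite: Kosinski1993, VI §6 and VIII proof of (1.2)] -/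
theorem helper_mfderiv_jA_transport : ∀ {M : Type} [TopologicalSpace M] [ChartedSpace (EuclideanHalfSpace 4) M] [IsManifold (𝓡∂ 4) ∞ M] [T2Space M] {M' : Type} [TopologicalSpace M'] [ChartedSpace (EuclideanHalfSpace 4) M'] [IsManifold (𝓡∂ 4) ∞ M'] [T2Space M'] {ι : Type} [Finite ι] {q : ι → Literature.Topology.FourManifolds.HandleAttachingMap 3 2 M} {P : Type} [TopologicalSpace P] [ChartedSpace (EuclideanHalfSpace 4) P] (D : Literature.Topology.FourManifolds.HandleAttachingMap.MultiAttachmentData q (𝓡∂ 4) P) (G : M ≃ₘ⟮𝓡∂ 4, 𝓡∂ 4⟯ M') (D' : Literature.Topology.FourManifolds.HandleAttachingMap.MultiAttachmentData (fun i => (q i).transport G) (𝓡∂ 4) P), (∀ a, D'.jA a = D.jA (Literature.Topology.FourManifolds.HandleAttachingMap.coresComplementCongr q G a)) → ∀ (a : ↥(Literature.Topology.FourManifolds.HandleAttachingMap.coresComplement q)) (v : EuclideanSpace ℝ (Fin 4)), D'.jA ⟨G a, Summit.SmoothPoincare4.SmoothPoincare4.Theorems.AcyclicBisectionExists.ModpBraidOrbits.apply_mem_coresComplement_transport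 q G a.2⟩ = D.jA a ∧ mfderiv (𝓡∂ 4) (𝓡∂ 4) D'.jA ⟨G a, Summit.SmoothPoincare4.SmoothPoincare4.Theorems.AcyclicBisectionExists.ModpBraidOrbits.apply_mem_coresComplement_transport q G a.2⟩ (mfderiv (𝓡∂ 4) (𝓡∂ 4) G (a : M) v) = mfderiv (𝓡∂ 4) (𝓡∂ 4) D.jA a v := by
  intro M _ _ _ _ M' _ _ _ _ ι _ q P _ _ D G D' hA a v
  exact ⟨jA_transport_apply_image D G D' hA a, mfderiv_jA_transport_apply_image D G D' hA a v⟩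

end Summit.SmoothPoincare4.SmoothPoincare4.Theorems.AcyclicBisectionExists.ModpBraidOrbits

end
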